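import Summits.RiemannHypothesis.RiemannHypothesis.Theorems.GroundBartaPolarPerronFrobeniusGapTransfer
import Summits.RiemannHypothesis.RiemannHypothesis.Theorems.GroundBartaPolarPerronFrobeniusFormDomainBottom
import Summits.RiemannHypothesis.RiemannHypothesis.Theorems.GroundBartaPolarPerronFrobeniusConeFormDomain
import HarnessLib

/-!
# The ground state IS the Ritz profile, up to the gap-certificate budget
(route `RiemannHypothesis/GroundBarta`, crux `PolarPerronFrobenius` = stmt-RiemannHypothesis-18390, helper; RH-free, no
definitions, no named facts, no sorry)

`GroundBartaPolarPerronFrobeniusGapTransfer` bounds the `L²` distance between a ground state and any even near-bottom TEST `v`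
(`integral_norm_sq_sub_le_of_gapCertificate`).  The certified near-bottom vectors of the cells are not tests but
non-negative even FORM-DOMAIN vectors `w = 𝟙_{[-b,b]} P₁(x/b)` with `P(w) + 𝓔_b(w) ≤ (M_b + δ)‖w‖²`
(`nearBottom_nonneg_*`).  This file closes the gap:

* `exists_even_nonneg_sphere_near` — a non-negative even form-domain vector `w` on `[-a, a]` with `∫|w|² = 1` and
  `P(w) + 𝓔_a(w) ≤ M_a + B` is approximated in `L²` by non-negative even `L²`-normalised window TESTS `v` with
  `Re Q(v) ≤ B + ε'`, for every `ε' > 0` (compress by dilation, mollify inside the freed margin with an even non-negative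
  bump, renormalise — the construction of `isWeilGroundState_of_energy_le`, kept inside the cone).
* `integral_norm_sq_sub_le_sqrt_add_sqrt` — the `L²` triangle inequality in integral form.
* `groundState_near_profile_of_gapCertificate` — **the ground state is the profile**: for an even-sector ground state `u`
  at `a`, a gap certificate `H(φ, m₂)` on the even window tests, Weil positivity at `a`, and such a profile `w` with budget
  `B` (`B + ε' < m₂`): some unit scalar `c` has `∫|c u − w|² ≤ (√(2(B + ε')/(m₂ − (B + ε'))) + √ε')²`.
  With the landed data at `a = 4023/5000` (`p80v1`, `B = 10⁻¹⁷`, `m₂ = 3·10⁻¹²`, `…GapCert8046`) this identifies EVERY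
  ground state there with the explicit degree-`56` Ritz polynomial profile up to `3.7·10⁻³` in `L²` (instantiated in
  `…GroundStateProfile8046`).

References: E. Bombieri, Rend. Mat. Acc. Lincei (9) 11 (2000) §4 Thm 3, Thm 5; M. Reed, B. Simon IV, Thm XIII.1–2.
Prover B, speedrun unit `sr-gb-rung-b` (gen 17).
-/

set_option linter.dupNamespace false

noncomputable section

open MeasureTheory Complex Filter Set
open scoped Real Topology ComplexConjugate

namespace Summit.RiemannHypothesis.RiemannHypothesis.Theorems.PolarPerronFrobenius

open Literature.NumberTheory.LFunctions
open Literature.NumberTheory.LFunctions.ConnesVanSuijlekom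
open Summit.RiemannHypothesis.RiemannHypothesis.Theorems.WeilGroundStateMarkovPart (integral_norm_sq_add_le)
open Summit.RiemannHypothesis.RiemannHypothesis.Theorems.OddSector
  (memLp_weilDilate weilDilate_eq_zero_of_notMem tendsto_weilPoleForm_of_window
    tendsto_integral_norm_sq_of_tendsto_sub)

/-! ### Non-negative even near-bottom TESTS from a near-bottom form-domain profile -/

/-- **Approximating a non-negative even form-domain profile by non-negative even window tests with controlled energy.**
Let `a > 0` and `w ∈ L²` vanish off `[-a, a]`, even, pointwise real `≥ 0`, with `∫|w|² = 1`, finite archimedean energy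
and `P(w) + 𝓔_a(w) ≤ M_a + B`.  Then for every `ε' > 0` there is a window test `v` on `[-a, a]`, even, pointwise real
`≥ 0`, with `∫|v|² = 1`, `Re Q(v) ≤ B + ε'` and `∫|v − w|² ≤ ε'`. [cite: Bombieri2000Weil, §4 proof of Thm 5 (dilation) and Thm 3] -/
theorem exists_even_nonneg_sphere_near {a B : ℝ} {w : ℝ → ℂ} (ha : 0 < a) (hw : MemLp w 2)
    (hws : ∀ x, x ∉ Icc (-a) a → w x = 0) (hwe : ∀ x, w (-x) = w x) (hwr : ∀ x, (w x).im = 0 ∧ 0 ≤ (w x).re)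
    (hwN : ∫ x, ‖w x‖ ^ 2 = (1 : ℝ))
    (hwE : IntegrableOn (fun t ↦ weilArchDensity t * weilIncrement w t) (Ioi 0))
    (hle : weilPoleForm w + weilDirichletEnergy a w ≤ weilMarkovConstant a + B) {ε' : ℝ} (hε' : 0 < ε') :
    ∃ v : ℝ → ℂ, IsWeilTest v ∧ tsupport v ⊆ Icc (-a) a ∧ (∀ x, v (-x) = v x) ∧
      (∀ x, (v x).im = 0 ∧ 0 ≤ (v x).re) ∧ ∫ x, ‖v x‖ ^ 2 = (1 : ℝ) ∧
      (weilQuadratic v).re ≤ B + ε' ∧ ∫ x, ‖v x - w x‖ ^ 2 ≤ ε' := by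
  -- adapted from `isWeilGroundState_of_energy_le` (…FormDomainBottom), kept inside the non-negative even cone
  set M : ℝ := weilMarkovConstant a with hMdef
  -- (1) interior dilates
  set η : ℕ → ℝ := fun n ↦ 1 / ((n : ℝ) + 1) with hηdef
  have hη0 : ∀ n, 0 ≤ η n := fun n ↦ by positivity
  have hηpos : ∀ n, 0 < η n := fun n ↦ by positivity
  have hη1 : ∀ n, η n ≤ 1 := fun n ↦ by
    rw [hηdef, div_le_one (by positivity)]; linarith [n.cast_nonneg (α := ℝ)]
  have hηm1 : ∀ n, -1 < η n := fun n ↦ by linarith [hη0 n]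
  have hηlim : Tendsto η atTop (𝓝 0) := tendsto_one_div_add_atTop_nhds_zero_nat
  set f : ℕ → ℝ → ℂ := fun n ↦ weilDilate (η n) w with hfdef
  have hfm : ∀ n, MemLp (f n) 2 := fun n ↦ memLp_weilDilate hw (hηm1 n)
  have hfs : ∀ n x, x ∉ Icc (-(a / (1 + η n))) (a / (1 + η n)) → f n x = 0 := fun n x hx ↦
    weilDilate_eq_zero_of_notMem (hηm1 n) hws hx
  have hba : ∀ n, a / (1 + η n) < a := fun n ↦ by
    rw [div_lt_iff₀ (by linarith [hη0 n])]; nlinarith [hηpos n]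
  have hfs' : ∀ n x, x ∉ Icc (-a) a → f n x = 0 := fun n x hx ↦
    hfs n x fun h ↦ hx ⟨by linarith [h.1, (hba n).le, neg_le_neg (hba n).le], h.2.trans (hba n).le⟩
  have hfe : ∀ n x, f n (-x) = f n x := fun n x ↦ by
    simp only [hfdef, weilDilate_apply, mul_neg, hwe]
  have hfr : ∀ n x, (f n x).im = 0 ∧ 0 ≤ (f n x).re := fun n x ↦ cone_weilDilate hwr (η n) x
  have hfN : ∀ n, ∫ x, ‖f n x‖ ^ 2 = 1 := fun n ↦ by
    rw [hfdef, integral_norm_sq_weilDilate w (hηm1 n), hwN]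
  obtain ⟨hfE, hElim⟩ := tendsto_weilDirichletEnergy_weilDilate_window a ha hw hws hwE hη0 hη1 hηlim
  have hfL : Tendsto (fun n ↦ ∫ x, ‖f n x - w x‖ ^ 2) atTop (𝓝 0) :=
    tendsto_integral_norm_sq_weilDilate_sub_window hw hws hη0 hη1 hηlim
  have hPlim : Tendsto (fun n ↦ weilPoleForm (f n)) atTop (𝓝 (weilPoleForm w)) :=
    tendsto_weilPoleForm_of_window hw hfm hws hfs' hfL
  -- (2) per dilate, an even non-negative mollified window test within `1/(n+1)` in mass, `L²` and pole form
  have hA : ∀ n, ∃ g : ℝ → ℂ, IsWeilTest g ∧ tsupport g ⊆ Icc (-a) a ∧ (∀ x, g (-x) = g x) ∧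
      (∀ x, (g x).im = 0 ∧ 0 ≤ (g x).re) ∧
      ∫ x, ‖g x - f n x‖ ^ 2 < 1 / ((n : ℝ) + 1) ∧
      |weilPoleForm g - weilPoleForm (f n)| < 1 / ((n : ℝ) + 1) ∧
      |(∫ x, ‖g x‖ ^ 2) - 1| < 1 / ((n : ℝ) + 1) ∧
      weilDirichletEnergy a g ≤ weilDirichletEnergy a (f n) := by
    intro n
    have hδ : (0 : ℝ) < 1 / ((n : ℝ) + 1) := by positivity
    obtain ⟨g, hgt, hge, hgr, hgs, hgD, hgL⟩ := exists_even_nonneg_mollified_seq (hfm n) (hfs n) (hfe n) (hfr n)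
    have hgm : ∀ k, MemLp (g k) 2 := fun k ↦ (hgt k).memLp_two
    have hmargin : 0 < a - a / (1 + η n) := by linarith [hba n]
    have hevS : ∀ᶠ k in atTop, tsupport (g k) ⊆ Icc (-a) a := by
      have : ∀ᶠ k : ℕ in atTop, 1 / ((k : ℝ) + 1) < a - a / (1 + η n) :=
        tendsto_one_div_add_atTop_nhds_zero_nat.eventually (eventually_lt_nhds hmargin)
      filter_upwards [this] with k hk
      exact (hgs k).trans (Icc_subset_Icc (by linarith) (by linarith))
    have hgs1 : ∀ k x, x ∉ Icc (-(a + 1)) (a + 1) → g k x = 0 := fun k x hx ↦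
      image_eq_zero_of_notMem_tsupport fun h ↦ hx (by
        have h' := hgs k h
        have hk1 : 1 / ((k : ℝ) + 1) ≤ 1 := by
          rw [div_le_one (by positivity)]; linarith [k.cast_nonneg (α := ℝ)]
        exact ⟨by linarith [h'.1, (hba n).le], by linarith [h'.2, (hba n).le]⟩)
    have hfs1 : ∀ x, x ∉ Icc (-(a + 1)) (a + 1) → f n x = 0 := fun x hx ↦
      hfs' n x fun h ↦ hx ⟨by linarith [h.1], by linarith [h.2]⟩
    have hNlim : Tendsto (fun k ↦ ∫ x, ‖g k x‖ ^ 2) atTop (𝓝 1) := by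
      have := tendsto_integral_norm_sq_of_tendsto_sub hgm (hfm n) hgL
      rwa [hfN n] at this
    have hPg : Tendsto (fun k ↦ weilPoleForm (g k)) atTop (𝓝 (weilPoleForm (f n))) :=
      tendsto_weilPoleForm_of_window (hfm n) hgm hfs1 hgs1 hgL
    have hev1 : ∀ᶠ k in atTop, ∫ x, ‖g k x - f n x‖ ^ 2 < 1 / ((n : ℝ) + 1) :=
      hgL.eventually (eventually_lt_nhds hδ)
    have hev2 : ∀ᶠ k in atTop, |weilPoleForm (g k) - weilPoleForm (f n)| < 1 / ((n : ℝ) + 1) := by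
      have := (Metric.tendsto_nhds.1 hPg) _ hδ
      simpa only [Real.dist_eq] using this
    have hev3 : ∀ᶠ k in atTop, |(∫ x, ‖g k x‖ ^ 2) - 1| < 1 / ((n : ℝ) + 1) := by
      have := (Metric.tendsto_nhds.1 hNlim) _ hδ
      simpa only [Real.dist_eq] using this
    obtain ⟨k, hkS, hk1, hk2, hk3⟩ := (hevS.and (hev1.and (hev2.and hev3))).exists
    exact ⟨g k, hgt k, hkS, hge k, hgr k, hk1, hk2, hk3, weilDirichletEnergy_le_of_increment_le (hgD k)
      (integrableOn_weilArchDensity_mul_weilIncrement (hgt k)) (hfE n)⟩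
  choose g hgt hgs hge hgr hgf hgP hgN hgE using hA
  have hgm : ∀ n, MemLp (g n) 2 := fun n ↦ (hgt n).memLp_two
  have hinv : Tendsto (fun n : ℕ ↦ 1 / ((n : ℝ) + 1)) atTop (𝓝 0) :=
    tendsto_one_div_add_atTop_nhds_zero_nat
  -- (3) masses and renormalisation
  set N : ℕ → ℝ := fun n ↦ ∫ x, ‖g n x‖ ^ 2 with hNdef
  have hN1 : ∀ n, |N n - 1| < 1 / ((n : ℝ) + 1) := hgN
  have hNpos : ∀ n, 0 < N n := fun n ↦ by
    have h1 : 1 / ((n : ℝ) + 1) ≤ 1 := by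
      rw [div_le_one (by positivity)]; linarith [n.cast_nonneg (α := ℝ)]
    have h2 := (abs_lt.1 (hN1 n)).1
    linarith
  have hNlim : Tendsto N atTop (𝓝 1) := by
    have h : Tendsto (fun n ↦ N n - 1) atTop (𝓝 0) :=
      squeeze_zero_norm (fun n ↦ (Real.norm_eq_abs _).trans_le (hN1 n).le) hinv
    simpa using h.add_const 1
  set s : ℕ → ℝ := fun n ↦ Real.sqrt (N n) with hsdef
  have hspos : ∀ n, 0 < s n := fun n ↦ Real.sqrt_pos.2 (hNpos n)
  have hssq : ∀ n, s n ^ 2 = N n := fun n ↦ Real.sq_sqrt (hNpos n).le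
  set c : ℕ → ℝ := fun n ↦ (s n)⁻¹ with hcdef
  have hcpos : ∀ n, 0 < c n := fun n ↦ inv_pos.2 (hspos n)
  have hcsq : ∀ n, c n * c n = (N n)⁻¹ := fun n ↦ by
    rw [hcdef, ← mul_inv, Real.mul_self_sqrt (hNpos n).le]
  set v : ℕ → ℝ → ℂ := fun n t ↦ (c n : ℂ) * g n t with hvdef
  have hvt : ∀ n, IsWeilTest (v n) := fun n ↦ (hgt n).const_mul (c n)
  have hvs : ∀ n, tsupport (v n) ⊆ Icc (-a) a := fun n ↦ tsupport_mul_subset_right.trans (hgs n)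
  have hvN : ∀ n, ∫ x, ‖v n x‖ ^ 2 = 1 := fun n ↦ by
    simp only [hvdef, norm_mul, mul_pow, Complex.norm_real, Real.norm_of_nonneg (hcpos n).le]
    rw [integral_const_mul, show c n ^ 2 = c n * c n by ring, hcsq, inv_mul_cancel₀ (hNpos n).ne']
  have hvm : ∀ n, MemLp (v n) 2 := fun n ↦ (hvt n).memLp_two
  have hve : ∀ n x, v n (-x) = v n x := fun n x ↦ by simp only [hvdef, hge n x]
  have hvr : ∀ n x, (v n x).im = 0 ∧ 0 ≤ (v n x).re := fun n x ↦ by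
    refine ⟨?_, ?_⟩
    · rw [Complex.im_ofReal_mul, (hgr n x).1, mul_zero]
    · rw [Complex.re_ofReal_mul]; exact mul_nonneg (hcpos n).le (hgr n x).2
  -- (4) energies: `Re Q(v n) ≤ (P(f n) + 𝓔_a(f n) + 1/(n+1))/N n − M → P(w) + 𝓔_a(w) − M ≤ B`
  have hQv : ∀ n, (weilQuadratic (v n)).re = (N n)⁻¹ * (weilQuadratic (g n)).re := fun n ↦ by
    simp only [hvdef]
    rw [weilQuadratic_const_mul, Complex.normSq_ofReal, Complex.re_ofReal_mul, hcsq]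
  set U : ℕ → ℝ := fun n ↦
    (weilPoleForm (f n) + weilDirichletEnergy a (f n) + 1 / ((n : ℝ) + 1)) / N n - M with hUdef
  have hup : ∀ n, (weilQuadratic (v n)).re ≤ U n := fun n ↦ by
    have hMarkov := weilQuadratic_re_eq_weilPoleForm_add_weilDirichletEnergy_sub (hgt n) (hgs n)
    have hP := (abs_lt.1 (hgP n)).2
    have hQg : (weilQuadratic (g n)).re ≤
        weilPoleForm (f n) + weilDirichletEnergy a (f n) + 1 / ((n : ℝ) + 1) - M * N n := by
      rw [hMarkov]; linarith [hgE n]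
    rw [hQv n, hUdef]
    have hNi : 0 ≤ (N n)⁻¹ := inv_nonneg.2 (hNpos n).le
    calc (N n)⁻¹ * (weilQuadratic (g n)).re
        ≤ (N n)⁻¹ * (weilPoleForm (f n) + weilDirichletEnergy a (f n) + 1 / ((n : ℝ) + 1) - M * N n) :=
          mul_le_mul_of_nonneg_left hQg hNi
      _ = (weilPoleForm (f n) + weilDirichletEnergy a (f n) + 1 / ((n : ℝ) + 1)) / N n - M := by
          have hN0 : N n ≠ 0 := (hNpos n).ne'
          rw [mul_sub, ← div_eq_inv_mul, show (N n)⁻¹ * (M * N n) = M by field_simp]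
  have hUlim : Tendsto U atTop (𝓝 ((weilPoleForm w + weilDirichletEnergy a w + 0) / 1 - M)) :=
    (((hPlim.add hElim).add hinv).div hNlim one_ne_zero).sub_const M
  rw [add_zero, div_one] at hUlim
  have hLB : weilPoleForm w + weilDirichletEnergy a w - M ≤ B := by linarith
  have hevU : ∀ᶠ n in atTop, U n < B + ε' := hUlim.eventually (eventually_lt_nhds (by linarith))
  -- (5) `v n → w` in `L²`
  have hL : Tendsto (fun n ↦ ∫ x, ‖v n x - w x‖ ^ 2) atTop (𝓝 0) := by
    have hvg : ∀ n, ∫ x, ‖v n x - g n x‖ ^ 2 ≤ (1 / ((n : ℝ) + 1)) ^ 2 := by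
      intro n
      have e : (fun x ↦ ‖v n x - g n x‖ ^ 2) = fun x ↦ (c n - 1) ^ 2 * ‖g n x‖ ^ 2 := by
        funext x
        simp only [hvdef]
        rw [show (c n : ℂ) * g n x - g n x = ((c n - 1 : ℝ) : ℂ) * g n x by push_cast; ring,
          norm_mul, mul_pow, Complex.norm_real, Real.norm_eq_abs, sq_abs]
      rw [e, integral_const_mul]
      have h1 : (c n - 1) ^ 2 * N n = (1 - s n) ^ 2 := by
        have hs0 : s n ≠ 0 := (hspos n).ne'
        have hc : c n = (s n)⁻¹ := rfl
        rw [hc, ← hssq n]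
        field_simp
      have h2 : |1 - s n| ≤ |1 - N n| := by
        rw [← hssq n, show 1 - s n ^ 2 = (1 - s n) * (1 + s n) by ring, abs_mul]
        have : 1 ≤ |1 + s n| := by rw [abs_of_pos (by linarith [hspos n])]; linarith [hspos n]
        nlinarith [abs_nonneg (1 - s n)]
      have h3 : |1 - N n| < 1 / ((n : ℝ) + 1) := by rw [abs_sub_comm]; exact hN1 n
      calc (c n - 1) ^ 2 * N n = |1 - s n| ^ 2 := by rw [h1, sq_abs]
        _ ≤ |1 - N n| ^ 2 := pow_le_pow_left₀ (abs_nonneg _) h2 2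
        _ ≤ (1 / ((n : ℝ) + 1)) ^ 2 := pow_le_pow_left₀ (abs_nonneg _) h3.le 2
    have hbnd : ∀ n, ∫ x, ‖v n x - w x‖ ^ 2 ≤
        2 * (1 / ((n : ℝ) + 1)) ^ 2 + (4 * (1 / ((n : ℝ) + 1)) + 4 * ∫ x, ‖f n x - w x‖ ^ 2) := by
      intro n
      have s1 := integral_norm_sq_add_le ((hvm n).sub (hgm n)) ((hgm n).sub hw)
      have e1 : (fun x ↦ ‖(v n - g n) x + (g n - w) x‖ ^ 2) = fun x ↦ ‖v n x - w x‖ ^ 2 := by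
        funext x; simp only [Pi.sub_apply, sub_add_sub_cancel]
      rw [e1] at s1
      have s2 := integral_norm_sq_add_le ((hgm n).sub (hfm n)) ((hfm n).sub hw)
      have e2 : (fun x ↦ ‖(g n - f n) x + (f n - w) x‖ ^ 2) = fun x ↦ ‖(g n - w) x‖ ^ 2 := by
        funext x; simp only [Pi.sub_apply, sub_add_sub_cancel]
      rw [e2] at s2
      simp only [Pi.sub_apply] at s1 s2 ⊢
      have h3 := hvg n
      have h4 := (hgf n).le
      linarith
    refine squeeze_zero (fun n ↦ integral_nonneg fun _ ↦ by positivity) hbnd ?_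
    have h1 : Tendsto (fun n : ℕ ↦ 2 * (1 / ((n : ℝ) + 1)) ^ 2) atTop (𝓝 (2 * 0 ^ 2)) :=
      (hinv.pow 2).const_mul 2
    have h2 : Tendsto (fun n : ℕ ↦ 4 * (1 / ((n : ℝ) + 1)) + 4 * ∫ x, ‖f n x - w x‖ ^ 2) atTop
        (𝓝 (4 * 0 + 4 * 0)) := (hinv.const_mul 4).add (hfL.const_mul 4)
    simpa using h1.add h2
  have hevL : ∀ᶠ n in atTop, ∫ x, ‖v n x - w x‖ ^ 2 < ε' := hL.eventually (eventually_lt_nhds hε')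
  obtain ⟨n, hnU, hnL⟩ := (hevU.and hevL).exists
  exact ⟨v n, hvt n, hvs n, hve n, hvr n, hvN n, ((hup n).trans hnU.le), hnL.le⟩

/-! ### The `L²` triangle inequality in integral form -/

/-- `∫|f − h|² ≤ (√∫|f − g|² + √∫|g − h|²)²` for `f, g, h ∈ L²`. [folklore] -/
theorem integral_norm_sq_sub_le_sqrt_add_sqrt {f g h : ℝ → ℂ} (hf : MemLp f 2) (hg : MemLp g 2) (hh : MemLp h 2) :
    ∫ x, ‖f x - h x‖ ^ 2 ≤
      (Real.sqrt (∫ x, ‖f x - g x‖ ^ 2) + Real.sqrt (∫ x, ‖g x - h x‖ ^ 2)) ^ 2 := by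
  have hAm : MemLp (fun x ↦ f x - g x) 2 := hf.sub hg
  have hBm : MemLp (fun x ↦ g x - h x) 2 := hg.sub hh
  have hexp := integral_norm_sq_add_mul hAm hBm 1
  have e : (fun x ↦ ‖f x - h x‖ ^ 2) = fun x ↦ ‖(f x - g x) + 1 * (g x - h x)‖ ^ 2 := by
    funext x; congr 2; ring
  rw [e, hexp]
  simp only [map_one, one_mul]
  have hcs : ‖∫ x, (f x - g x) * conj (g x - h x)‖ ≤
      Real.sqrt (∫ x, ‖f x - g x‖ ^ 2) * Real.sqrt (∫ x, ‖g x - h x‖ ^ 2) := by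
    have h0 := norm_integral_mul_conj_sub_le hAm hBm (MemLp.zero' : MemLp (fun _ : ℝ ↦ (0 : ℂ)) 2)
    simpa using h0
  have hre : (∫ x, (f x - g x) * conj (g x - h x)).re ≤
      Real.sqrt (∫ x, ‖f x - g x‖ ^ 2) * Real.sqrt (∫ x, ‖g x - h x‖ ^ 2) :=
    (Complex.re_le_norm _).trans hcs
  have hA0 : 0 ≤ ∫ x, ‖f x - g x‖ ^ 2 := integral_nonneg fun _ ↦ by positivity
  have hB0 : 0 ≤ ∫ x, ‖g x - h x‖ ^ 2 := integral_nonneg fun _ ↦ by positivity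
  nlinarith [Real.sq_sqrt hA0, Real.sq_sqrt hB0, Real.sqrt_nonneg (∫ x, ‖f x - g x‖ ^ 2),
    Real.sqrt_nonneg (∫ x, ‖g x - h x‖ ^ 2)]

/-! ### The ground state is the profile -/

/-- **The ground state is the near-bottom profile, up to the gap-certificate budget.**  Let `a > 0` carry Weil positivity,
`u` an even-sector ground state at `a`, `H(φ, m₂)` a gap certificate on the even window tests (`φ ∈ L²`), and `w` a
non-negative even form-domain profile on `[-a, a]` with `∫|w|² = 1` and `P(w) + 𝓔_a(w) ≤ M_a + B`.  If `0 < ε'` and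
`B + ε' < m₂`, then some unit scalar `c` has `∫|c u − w|² ≤ (√(2(B + ε')/(m₂ − (B + ε'))) + √ε')²`.
[cite: Bombieri2000Weil, §4 Thm 3, Thm 5] -/
theorem groundState_near_profile_of_gapCertificate {a B m₂ ε' : ℝ} {u φ w : ℝ → ℂ} (ha : 0 < a)
    (hpos : WeilPositivityOn a) (hu : IsWeilEvenGroundState a u) (hφ : MemLp φ 2)
    (H : ∀ k : ℝ → ℂ, IsWeilTest k → tsupport k ⊆ Icc (-a) a → (∀ t, k (-t) = k t) →
      ∫ t, k t * conj (φ t) = 0 → m₂ * ∫ t, ‖k t‖ ^ 2 ≤ (weilQuadratic k).re)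
    (hw : MemLp w 2) (hws : ∀ x, x ∉ Icc (-a) a → w x = 0) (hwe : ∀ x, w (-x) = w x)
    (hwr : ∀ x, (w x).im = 0 ∧ 0 ≤ (w x).re) (hwN : ∫ x, ‖w x‖ ^ 2 = (1 : ℝ))
    (hwE : IntegrableOn (fun t ↦ weilArchDensity t * weilIncrement w t) (Ioi 0))
    (hle : weilPoleForm w + weilDirichletEnergy a w ≤ weilMarkovConstant a + B)
    (hε' : 0 < ε') (hm : B + ε' < m₂) :
    ∃ c : ℂ, ‖c‖ = 1 ∧
      ∫ t, ‖c * u t - w t‖ ^ 2 ≤ (Real.sqrt (2 * (B + ε') / (m₂ - (B + ε'))) + Real.sqrt ε') ^ 2 := by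
  obtain ⟨v, hv, hvs, hve, hvr, hv1, hQv, hvw⟩ := exists_even_nonneg_sphere_near ha hw hws hwe hwr hwN hwE hle hε'
  -- `0 ≤ ε_ev(a) ≤ Re Q(v) ≤ B + ε' < m₂`
  have hε0 : 0 ≤ weilEvenGroundEnergy a :=
    ((weilGroundEnergy_nonneg_iff_holds ha).2 hpos).trans (weilGroundEnergy_le_weilEvenGroundEnergy a)
  have hεv : weilEvenGroundEnergy a ≤ (weilQuadratic v).re := hu.weilEvenGroundEnergy_le hv hvs hve hv1
  have hεm : weilEvenGroundEnergy a < m₂ := by linarith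
  -- fix the phase of `u` against `v`
  set p : ℂ := ∫ t, v t * conj (u t) with hp
  obtain ⟨c, hc1, hcp⟩ : ∃ c : ℂ, ‖c‖ = 1 ∧ conj c * p = (‖p‖ : ℂ) := by
    by_cases hp0 : p = 0
    · exact ⟨1, norm_one, by simp [hp0]⟩
    · refine ⟨p / (‖p‖ : ℂ), ?_, ?_⟩
      · rw [norm_div, Complex.norm_real, Real.norm_of_nonneg (norm_nonneg _),
          div_self (norm_ne_zero_iff.2 hp0)]
      · have hn : (‖p‖ : ℂ) ≠ 0 := Complex.ofReal_ne_zero.2 (norm_ne_zero_iff.2 hp0)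
        rw [map_div₀, Complex.conj_ofReal, div_mul_eq_mul_div, div_eq_iff hn, Complex.conj_mul', sq]
  have hcu : IsWeilEvenGroundState a (fun t ↦ c * u t) := hu.const_mul hc1
  have hpair : ∫ t, v t * conj (c * u t) = (‖p‖ : ℂ) := by
    have e : (fun t ↦ v t * conj (c * u t)) = fun t ↦ conj c * (v t * conj (u t)) := by
      funext t; simp only [map_mul]; ring
    rw [e, integral_const_mul, ← hp, hcp]
  have hreal : (∫ t, v t * conj (c * u t)).im = 0 := by rw [hpair, Complex.ofReal_im]
  have hposp : 0 ≤ (∫ t, v t * conj (c * u t)).re := by rw [hpair, Complex.ofReal_re]; exact norm_nonneg _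
  have hdist := integral_norm_sq_sub_le_of_gapCertificate hcu hεm hφ H hv hvs hve hv1 hreal hposp
  -- the proximity budget
  have hden : 0 < m₂ - weilEvenGroundEnergy a := by linarith
  have hden' : 0 < m₂ - (B + ε') := by linarith
  have hbud : 2 * (((weilQuadratic v).re - weilEvenGroundEnergy a) / (m₂ - weilEvenGroundEnergy a)) ≤
      2 * (B + ε') / (m₂ - (B + ε')) := by
    rw [mul_div_assoc]
    refine mul_le_mul_of_nonneg_left ?_ (by norm_num)
    rw [div_le_div_iff₀ hden hden']
    have h1 : ((weilQuadratic v).re - weilEvenGroundEnergy a) * (m₂ - (B + ε')) ≤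
        ((weilQuadratic v).re - weilEvenGroundEnergy a) * (m₂ - weilEvenGroundEnergy a) :=
      mul_le_mul_of_nonneg_left (by linarith) (by linarith)
    have h2 : ((weilQuadratic v).re - weilEvenGroundEnergy a) * (m₂ - weilEvenGroundEnergy a) ≤
        (B + ε') * (m₂ - weilEvenGroundEnergy a) := mul_le_mul_of_nonneg_right (by linarith) hden.le
    linarith
  have h1 : ∫ t, ‖v t - c * u t‖ ^ 2 ≤ 2 * (B + ε') / (m₂ - (B + ε')) := hdist.trans hbud
  -- triangle inequality: `‖cu − w‖ ≤ ‖cu − v‖ + ‖v − w‖`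
  refine ⟨c, hc1, ?_⟩
  have hcum : MemLp (fun t ↦ c * u t) 2 := hcu.memLp
  have htri := integral_norm_sq_sub_le_sqrt_add_sqrt hcum (isWeilTest_memLp hv) hw
  have hs1 : Real.sqrt (∫ x, ‖c * u x - v x‖ ^ 2) ≤ Real.sqrt (2 * (B + ε') / (m₂ - (B + ε'))) := by
    refine Real.sqrt_le_sqrt ?_
    have e : (fun x ↦ ‖c * u x - v x‖ ^ 2) = fun x ↦ ‖v x - c * u x‖ ^ 2 := by
      funext x; rw [norm_sub_rev]
    rw [e]; exact h1
  have hs2 : Real.sqrt (∫ x, ‖v x - w x‖ ^ 2) ≤ Real.sqrt ε' := Real.sqrt_le_sqrt hvw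
  have hS0 : 0 ≤ Real.sqrt (∫ x, ‖c * u x - v x‖ ^ 2) + Real.sqrt (∫ x, ‖v x - w x‖ ^ 2) :=
    add_nonneg (Real.sqrt_nonneg _) (Real.sqrt_nonneg _)
  exact htri.trans (pow_le_pow_left₀ hS0 (add_le_add hs1 hs2) 2)

/-! ### Rigidity tools: two functions near one profile (appended by prover B g18) -/

/-- A real multiple of an `L²` profile is `L²` (the normalised profiles `‖w‖₂⁻¹ • w` of the windows). [folklore] -/
theorem memLp_smul_profile {w : ℝ → ℂ} (hw : MemLp w 2) (k : ℝ) : MemLp (k • w) 2 :=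
  hw.const_smul k

/-- **Two `L²` functions within `ρ` of the same `W` (in `∫|·|²`) are within `4ρ` of each other** — the rigidity step
behind "any two ground states of any two windows of a band coincide": both are near the one band profile. [folklore] -/
theorem integral_norm_sq_sub_le_four_mul_of_near {f g W : ℝ → ℂ} {ρ : ℝ} (hf : MemLp f 2) (hg : MemLp g 2)
    (hW : MemLp W 2) (hρ : 0 ≤ ρ) (h1 : ∫ t, ‖f t - W t‖ ^ 2 ≤ ρ) (h2 : ∫ t, ‖g t - W t‖ ^ 2 ≤ ρ) :
    ∫ t, ‖f t - g t‖ ^ 2 ≤ 4 * ρ := by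
  have h2' : ∫ t, ‖W t - g t‖ ^ 2 ≤ ρ := by
    have e : (fun t ↦ ‖W t - g t‖ ^ 2) = fun t ↦ ‖g t - W t‖ ^ 2 := by
      funext t; rw [norm_sub_rev]
    rw [e]; exact h2
  refine (integral_norm_sq_sub_le_sqrt_add_sqrt hf hW hg).trans ?_
  calc (Real.sqrt (∫ t, ‖f t - W t‖ ^ 2) + Real.sqrt (∫ t, ‖W t - g t‖ ^ 2)) ^ 2
      ≤ (Real.sqrt ρ + Real.sqrt ρ) ^ 2 :=
        pow_le_pow_left₀ (add_nonneg (Real.sqrt_nonneg _) (Real.sqrt_nonneg _))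
          (add_le_add (Real.sqrt_le_sqrt h1) (Real.sqrt_le_sqrt h2')) 2
    _ = 4 * ρ := by rw [← two_mul, mul_pow, Real.sq_sqrt hρ]; norm_num

/-- **Two functions near one profile with different budgets**: `∫|f − W|² ≤ ρ₁`, `∫|g − W|² ≤ ρ₂` give
`∫|f − g|² ≤ (√ρ₁ + √ρ₂)²` (ground states of two windows of two adjacent bands, each near its own band profile, once
the two profiles are compared). [folklore] -/
theorem integral_norm_sq_sub_le_of_near_near {f g W : ℝ → ℂ} {ρ₁ ρ₂ : ℝ} (hf : MemLp f 2) (hg : MemLp g 2)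
    (hW : MemLp W 2) (h1 : ∫ t, ‖f t - W t‖ ^ 2 ≤ ρ₁) (h2 : ∫ t, ‖g t - W t‖ ^ 2 ≤ ρ₂) :
    ∫ t, ‖f t - g t‖ ^ 2 ≤ (Real.sqrt ρ₁ + Real.sqrt ρ₂) ^ 2 := by
  have h2' : ∫ t, ‖W t - g t‖ ^ 2 ≤ ρ₂ := by
    have e : (fun t ↦ ‖W t - g t‖ ^ 2) = fun t ↦ ‖g t - W t‖ ^ 2 := by
      funext t; rw [norm_sub_rev]
    rw [e]; exact h2
  refine (integral_norm_sq_sub_le_sqrt_add_sqrt hf hW hg).trans ?_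
  exact pow_le_pow_left₀ (add_nonneg (Real.sqrt_nonneg _) (Real.sqrt_nonneg _))
    (add_le_add (Real.sqrt_le_sqrt h1) (Real.sqrt_le_sqrt h2')) 2

/-- **Two even-sector ground states of ONE window are rigid up to the certificate budget**: with the data of
`groundState_near_profile_of_gapCertificate`, any two even-sector ground states `u₁, u₂` at `a` satisfy
`∫|c₁ u₁ − c₂ u₂|² ≤ 4 (√(2(B + ε')/(m₂ − (B + ε'))) + √ε')²` for unit scalars `c₁, c₂` (a quantitative simplicity
statement for the bottom of the even sector at a certified window). [cite: Bombieri2000Weil, §4 Thm 3, Thm 5] -/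
theorem groundStates_rigid_of_gapCertificate {a B m₂ ε' : ℝ} {u₁ u₂ φ w : ℝ → ℂ} (ha : 0 < a)
    (hpos : WeilPositivityOn a) (hu₁ : IsWeilEvenGroundState a u₁) (hu₂ : IsWeilEvenGroundState a u₂)
    (hφ : MemLp φ 2)
    (H : ∀ k : ℝ → ℂ, IsWeilTest k → tsupport k ⊆ Icc (-a) a → (∀ t, k (-t) = k t) →
      ∫ t, k t * conj (φ t) = 0 → m₂ * ∫ t, ‖k t‖ ^ 2 ≤ (weilQuadratic k).re)
    (hw : MemLp w 2) (hws : ∀ x, x ∉ Icc (-a) a → w x = 0) (hwe : ∀ x, w (-x) = w x)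
    (hwr : ∀ x, (w x).im = 0 ∧ 0 ≤ (w x).re) (hwN : ∫ x, ‖w x‖ ^ 2 = (1 : ℝ))
    (hwE : IntegrableOn (fun t ↦ weilArchDensity t * weilIncrement w t) (Ioi 0))
    (hle : weilPoleForm w + weilDirichletEnergy a w ≤ weilMarkovConstant a + B)
    (hε' : 0 < ε') (hm : B + ε' < m₂) :
    ∃ c₁ c₂ : ℂ, ‖c₁‖ = 1 ∧ ‖c₂‖ = 1 ∧
      ∫ t, ‖c₁ * u₁ t - c₂ * u₂ t‖ ^ 2 ≤
        4 * (Real.sqrt (2 * (B + ε') / (m₂ - (B + ε'))) + Real.sqrt ε') ^ 2 := by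
  obtain ⟨c₁, hc₁, h₁⟩ :=
    groundState_near_profile_of_gapCertificate ha hpos hu₁ hφ H hw hws hwe hwr hwN hwE hle hε' hm
  obtain ⟨c₂, hc₂, h₂⟩ :=
    groundState_near_profile_of_gapCertificate ha hpos hu₂ hφ H hw hws hwe hwr hwN hwE hle hε' hm
  exact ⟨c₁, c₂, hc₁, hc₂, integral_norm_sq_sub_le_four_mul_of_near ((hu₁.const_mul hc₁).memLp)
    ((hu₂.const_mul hc₂).memLp) hw (sq_nonneg _) h₁ h₂⟩

end Summit.RiemannHypothesis.RiemannHypothesis.Theorems.PolarPerronFrobenius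

end
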